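import Literature.AlgebraicGeometry.Motives.RigidTuples
import Literature.AlgebraicGeometry.Motives.ScottLemma
import Literature.AlgebraicGeometry.Motives.RigidityIndexEven
import Mathlib.LinearAlgebra.Trace
import Mathlib.LinearAlgebra.Contraction
import HarnessLib

/-!
# Katz's rigidity criterion for tuples: index of rigidity `≤ 2`, and `= 2` ⟹ linearly rigid

Topic `Literature/AlgebraicGeometry/Motives`; proofs for the named fact
`DettweilerReiter2000_lemma_4_7` of `RigidTuples.lean` ([DettweilerReiter2000, Lemma 4.7] =
[Katz1996, Thm. 1.1.2]; general characteristic [StrambachVolklein1999]): for an irreducible tuple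
`T = (T_i)_{i<r}` in `GL(V)` with `T_∞ = 1` over an algebraically closed field,
`T` linearly rigid ⟺ `rig(T) = 2`.  Dettweiler–Reiter do not prove it ("proved by Deligne in
Simpson (1990, Lemma 6) and by Katz (1996, Theorem 1.1.2) in characteristic zero; the general case
in Strambach–Völklein (1999)"); we follow the linear-algebra proof printed in
[Haraoka2020, Thm. 7.8] (after Katz and Völklein–Strambach), with Hom spaces rendered by Mathlib's
`Representation.IntertwiningMap`.

## What is proved

* `RigidTuple.rigidityIndex_le_finrank_add` — **Katz's inequality**: if `T'_i ∼ T_i` for all `i`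
  and `T_∞ = T'_∞ = 1` then `rig(T) ≤ dim Hom(T', T) + dim Hom(T, T')`
  ([Haraoka2020, proof of Thm. 7.8]: Scott's lemma `scott_finrank_le` for `W = End V`,
  `σ_i(A) = T_i A T'_i⁻¹` = Mathlib's `Representation.linHom ρ' ρ`, whose fixed spaces are
  `F(σ_i) ≅ C(T_i)` (`A ↦ A c` for `T'_i = c T_i c⁻¹`), `F(Σ) = Hom(T', T)`, and
  `F(Σ*) ≅ Hom(T, T')` under the trace pairing `B ↦ tr(· B)`);
* `RigidTuple.rigidityIndex_le_two` — [Haraoka2020, Thm. 7.8, first assertion]: `rig(T) ≤ 2` for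
  `T` irreducible (`T' = T` and Schur, Mathlib's `finrank_intertwiningMap_self`);
* `RigidTuple.isLinearlyRigid_of_rigidityIndex_eq_two` — **Lemma 4.7 "⟸"** (= [Katz1996,
  Thm. 1.1.2]: cohomologically rigid ⟹ physically rigid), over any field: `rig(T) = 2` gives a
  nonzero intertwiner `T' → T` or `T → T'`, invertible since `T` is irreducible;
* `DettweilerReiter2000_lemma_4_7_iff_two_le`, `DettweilerReiter2000_lemma_4_7_iff_pos`: the
  named fact is thereby EQUIVALENT to its remaining direction "linearly rigid ⟹ `rig(T) ≥ 2`",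
  and, the index being even (`even_rigidityIndex`, [Haraoka2020, Prop. 7.7],
  file `RigidityIndexEven.lean`), to "linearly rigid ⟹ `rig(T) > 0`".

## What is NOT proved here (and why)

The direction "linearly rigid ⟹ `rig = 2`" ([Haraoka2020, Thm. 7.8, third part];
[StrambachVolklein1999]; Deligne–Simpson): every printed proof is a dimension count of algebraic
varieties — `G = SL_n × ∏ Z(T_i)` acts transitively on the fibre `π⁻¹(1)` of
`π : GL_n^{r} → SL_n`, `(C_i) ↦ ∏ C_i T_i C_i⁻¹`, whence `dim G ≥ dim π⁻¹(1) ≥ r n² - (n² - 1)` —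
which needs the fibre-dimension theorem and dimensions of orbits/images of morphisms (absent from
Mathlib at this pin); the named fact stays, `…_iff_two_le` / `…_iff_pos` record what is missing.

References: [DettweilerReiter2000] Lemma 4.7, Def. 4.3, 4.6; [Katz1996] Thm. 1.1.2; [Haraoka2020]
Lemma 7.9, Prop. 7.7, Thm. 7.8 (pp. 150–154); [StrambachVolklein1999]; [Scott1977].
-/

noncomputable section

namespace Literature.AlgebraicGeometry.Motives

open MiddleConvolution Module

universe u v

namespace RigidTuple

/-! ### The tuple `σ_i : A ↦ T_i A T'_i⁻¹` on `End V` (`Representation.linHom ρ' ρ`) -/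

section Hom

variable {K : Type*} [Field K] {V : Type*} [AddCommGroup V] [Module K V] {r : ℕ}

/-- The fixed space of `σ_g : A ↦ ρ(g) A ρ'(g)⁻¹` (Mathlib's `linHom ρ' ρ g`) is
`{A | ρ(g) A = A ρ'(g)}`. [folklore] -/
theorem mem_ker_linHom_sub_one_iff {G : Type*} [Group G] (ρ ρ' : Representation K G V) (g : G)
    (A : Module.End K V) :
    A ∈ LinearMap.ker (Representation.linHom ρ' ρ g - 1) ↔ ρ g * A = A * ρ' g := by
  rw [LinearMap.mem_ker, LinearMap.sub_apply, sub_eq_zero, Representation.linHom_apply,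
    Module.End.one_apply]
  constructor
  · intro h
    ext w
    simpa using LinearMap.congr_fun h (ρ' g w)
  · intro h
    ext v
    have := LinearMap.congr_fun h (ρ' g⁻¹ v)
    simp only [Module.End.mul_apply, Representation.self_inv_apply] at this
    simpa using this

/-- `A ∈ End V` lies in the common fixed space `F(Σ)` of the `σ_i` iff it intertwines the
generators, `A T'_i = T_i A` for all `i`. [folklore] -/
theorem mem_iInf_ker_linHom_sub_one_iff (ρ ρ' : Representation K (FreeGroup (Fin r)) V)
    (A : Module.End K V) :
    A ∈ (⨅ i, LinearMap.ker (Representation.linHom ρ' ρ (FreeGroup.of i) - 1)) ↔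
      ∀ i, A ∘ₗ ρ' (FreeGroup.of i) = ρ (FreeGroup.of i) ∘ₗ A := by
  rw [Submodule.mem_iInf]
  simp only [mem_ker_linHom_sub_one_iff, Module.End.mul_eq_comp, eq_comm]

/-- `F(Σ) = {A | T_i A = A T'_i ∀ i} ≅ Hom(T', T)`, the intertwining maps `ρ' → ρ` of the free
group (a map intertwining the generators intertwines, `comp_eq_comp_of_generators`); in particular
`dim F(Σ) = dim Hom(T', T)`. [folklore] -/
theorem finrank_iInf_ker_linHom_sub_one (ρ ρ' : Representation K (FreeGroup (Fin r)) V) :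
    finrank K (⨅ i, LinearMap.ker (Representation.linHom ρ' ρ (FreeGroup.of i) - 1) :
      Submodule K (Module.End K V)) = finrank K (ρ'.IntertwiningMap ρ) :=
  LinearEquiv.finrank_eq
    { toFun := fun A => ⟨A.1, comp_eq_comp_of_generators ρ' ρ A.1
        ((mem_iInf_ker_linHom_sub_one_iff ρ ρ' A.1).1 A.2)⟩
      map_add' := fun _ _ => rfl
      map_smul' := fun _ _ => rfl
      invFun := fun f => ⟨f.toLinearMap, (mem_iInf_ker_linHom_sub_one_iff ρ ρ' _).2 fun i =>
        f.isIntertwining' (FreeGroup.of i)⟩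
      left_inv := fun _ => rfl
      right_inv := fun _ => rfl }

/-- A nonzero `A ∈ F(Σ)` (an intertwiner `T' → T`) is invertible when `T` is irreducible: its image
is a nonzero subrepresentation. [folklore] -/
theorem isUnit_of_mem_iInf_ker_linHom_sub_one [FiniteDimensional K V]
    {ρ ρ' : Representation K (FreeGroup (Fin r)) V} (hirr : ρ.IsIrreducible) {A : Module.End K V}
    (hA : A ∈ (⨅ i, LinearMap.ker (Representation.linHom ρ' ρ (FreeGroup.of i) - 1)))
    (hA0 : A ≠ 0) : IsUnit A := by
  haveI := hirr
  let f : ρ'.IntertwiningMap ρ :=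
    ⟨A, comp_eq_comp_of_generators ρ' ρ A ((mem_iInf_ker_linHom_sub_one_iff ρ ρ' A).1 hA)⟩
  rcases IsSimpleOrder.eq_bot_or_eq_top f.range with h | h
  · exfalso
    apply hA0
    ext v
    have hv : f v ∈ f.range := ⟨v, rfl⟩
    rw [h] at hv
    exact (Submodule.mem_bot K).1 hv
  · exact (LinearMap.isUnit_iff_range_eq_top A).2 (congrArg Subrepresentation.toSubmodule h)

/-- A nonzero intertwiner `T → T'` (`B T_i = T'_i B`) is invertible when `T` is irreducible: its
kernel is a proper subrepresentation (Mathlib's `injective_or_eq_zero`). [folklore] -/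
theorem isUnit_of_mem_iInf_ker_linHom_sub_one' [FiniteDimensional K V]
    {ρ ρ' : Representation K (FreeGroup (Fin r)) V} (hirr : ρ.IsIrreducible) {B : Module.End K V}
    (hB : B ∈ (⨅ i, LinearMap.ker (Representation.linHom ρ ρ' (FreeGroup.of i) - 1)))
    (hB0 : B ≠ 0) : IsUnit B := by
  haveI := hirr
  let f : ρ.IntertwiningMap ρ' :=
    ⟨B, comp_eq_comp_of_generators ρ ρ' B ((mem_iInf_ker_linHom_sub_one_iff ρ' ρ B).1 hB)⟩
  rcases Representation.IsIrreducible.injective_or_eq_zero f with h | h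
  · exact (LinearMap.isUnit_iff_ker_eq_bot B).2 (LinearMap.ker_eq_bot.2 h)
  · exact absurd (congrArg Representation.IntertwiningMap.toLinearMap h) hB0

/-- For `T'_g = c T_g c⁻¹` the fixed space `{A | T_g A = A T'_g}` of `σ_g` is isomorphic to the
centraliser of `T_g` via `A ↦ A c`, so `dim F(σ_g) = dim C(T_g)` ([Haraoka2020, proof of Thm. 7.8]:
"`d(σ_i) = n² - dim Z(M_i)`"). [cite: Haraoka2020, Theorem 7.8] -/
theorem finrank_ker_linHom_sub_one [FiniteDimensional K V] {G : Type*} [Group G]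
    (ρ ρ' : Representation K G V) (g : G) (hc : IsConj (ρ g) (ρ' g)) :
    finrank K (LinearMap.ker (Representation.linHom ρ' ρ g - 1)) = centralizerDim (ρ g) := by
  obtain ⟨c, hc⟩ := hc
  have hc' : ρ' g = ↑c * ρ g * ↑c⁻¹ := by rw [hc.eq, mul_assoc, Units.mul_inv, mul_one]
  unfold centralizerDim
  rw [← Subalgebra.finrank_toSubmodule]
  refine LinearEquiv.finrank_eq (LinearEquiv.ofLinear
    ((LinearMap.mulRight K (c : Module.End K V)).restrict (p := LinearMap.ker _)
      (q := Subalgebra.toSubmodule (Subalgebra.centralizer K {ρ g})) fun A hA => ?_)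
    ((LinearMap.mulRight K (↑c⁻¹ : Module.End K V)).restrict
      (p := Subalgebra.toSubmodule (Subalgebra.centralizer K {ρ g})) (q := LinearMap.ker _)
      fun B hB => ?_) ?_ ?_)
  · rw [mem_ker_linHom_sub_one_iff] at hA
    rw [Subalgebra.mem_toSubmodule, Subalgebra.mem_centralizer_iff]
    intro x hx
    rw [Set.mem_singleton_iff] at hx
    subst hx
    rw [LinearMap.mulRight_apply, ← mul_assoc, hA, mul_assoc, ← hc.eq, ← mul_assoc]
  · rw [Subalgebra.mem_toSubmodule, Subalgebra.mem_centralizer_iff] at hB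
    rw [mem_ker_linHom_sub_one_iff, LinearMap.mulRight_apply, ← mul_assoc, hB (ρ g) rfl, hc']
    simp only [mul_assoc, Units.inv_mul_cancel_left]
  · apply LinearMap.ext
    intro B
    ext1
    simp [LinearMap.restrict_apply, mul_assoc]
  · apply LinearMap.ext
    intro A
    ext1
    simp [LinearMap.restrict_apply, mul_assoc]

/-- **The dual side** ([Haraoka2020, proof of Thm. 7.8]): under the trace pairing
`Φ : B ↦ (A ↦ tr(A B))` of `End V` with its dual (non-degenerate: test against the rank-one maps
`w ↦ φ(w) v`), the transpose of `σ_g` is `Φ B ↦ Φ(ρ'(g)⁻¹ B ρ(g))` (cyclicity of the trace), so the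
functionals fixed by every `σ_iᵀ` are `Φ` of the intertwiners `T → T'`:
`dim F(Σ*) = dim Hom(T, T')`. [cite: Haraoka2020, Theorem 7.8] -/
theorem finrank_iInf_ker_dualMap_linHom [FiniteDimensional K V]
    (ρ ρ' : Representation K (FreeGroup (Fin r)) V) :
    finrank K (⨅ i, LinearMap.ker ((Representation.linHom ρ' ρ (FreeGroup.of i)).dualMap - 1) :
      Submodule K (Module.Dual K (Module.End K V))) = finrank K (ρ.IntertwiningMap ρ') := by
  -- the trace pairing `Φ B A = tr(A B)` and its non-degeneracy
  let Φ : Module.End K V →ₗ[K] Module.Dual K (Module.End K V) :=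
    (LinearMap.mul K (Module.End K V)).flip.compr₂ (LinearMap.trace K V)
  have hΦ : ∀ B A, Φ B A = LinearMap.trace K V (A * B) := fun _ _ => rfl
  have hinj : Function.Injective Φ := by
    rw [← LinearMap.ker_eq_bot, Submodule.eq_bot_iff]
    intro B hB
    rw [LinearMap.mem_ker] at hB
    ext v
    refine (Module.forall_dual_apply_eq_zero_iff K (B v)).1 fun φ => ?_
    have key : dualTensorHom K V V (φ ⊗ₜ v) * B = dualTensorHom K V V ((φ ∘ₗ B) ⊗ₜ v) := by
      ext w
      simp [dualTensorHom_apply]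
    have := LinearMap.congr_fun hB (dualTensorHom K V V (φ ⊗ₜ v))
    rw [hΦ, key, LinearMap.trace_eq_contract_apply, contractLeft_apply] at this
    simpa using this
  let e : Module.End K V ≃ₗ[K] Module.Dual K (Module.End K V) :=
    Φ.linearEquivOfInjective hinj Subspace.dual_finrank_eq.symm
  -- the transpose of `σ_g` under `Φ`
  have htrans : ∀ (g : FreeGroup (Fin r)) (B : Module.End K V),
      (Representation.linHom ρ' ρ g).dualMap (Φ B) = Φ (ρ' g⁻¹ * B * ρ g) := by
    intro g B
    ext A
    rw [LinearMap.dualMap_apply, hΦ, hΦ, Representation.linHom_apply,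
      show (ρ g ∘ₗ A ∘ₗ ρ' g⁻¹) * B = ρ g * (A * ρ' g⁻¹ * B) by
        simp [Module.End.mul_eq_comp, LinearMap.comp_assoc],
      LinearMap.trace_mul_comm]
    simp [mul_assoc]
  -- `Φ B` is fixed by all `σ_iᵀ` iff `B` intertwines `T → T'`
  have hmem : ∀ B : Module.End K V, Φ B ∈ (⨅ i, LinearMap.ker
      ((Representation.linHom ρ' ρ (FreeGroup.of i)).dualMap - 1)) ↔
        B ∈ (⨅ i, LinearMap.ker (Representation.linHom ρ ρ' (FreeGroup.of i) - 1)) := by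
    intro B
    rw [Submodule.mem_iInf, Submodule.mem_iInf]
    refine forall_congr' fun i => ?_
    rw [LinearMap.mem_ker, LinearMap.sub_apply, sub_eq_zero, Module.End.one_apply, htrans,
      hinj.eq_iff, mem_ker_linHom_sub_one_iff]
    constructor
    · intro h
      calc ρ' (FreeGroup.of i) * B
          = ρ' (FreeGroup.of i) * (ρ' (FreeGroup.of i)⁻¹ * B * ρ (FreeGroup.of i)) := by rw [h]
        _ = B * ρ (FreeGroup.of i) := by
            rw [← mul_assoc, ← mul_assoc, ← map_mul, mul_inv_cancel, map_one, one_mul]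
    · intro h
      rw [mul_assoc, ← h, ← mul_assoc, ← map_mul, inv_mul_cancel, map_one, one_mul]
  have hF : (⨅ i, LinearMap.ker ((Representation.linHom ρ' ρ (FreeGroup.of i)).dualMap - 1)) =
      (⨅ i, LinearMap.ker (Representation.linHom ρ ρ' (FreeGroup.of i) - 1)).map
        e.toLinearMap := by
    rw [Submodule.map_equiv_eq_comap_symm]
    ext l
    obtain ⟨B, rfl⟩ := e.surjective l
    rw [Submodule.mem_comap, LinearEquiv.coe_coe, LinearEquiv.symm_apply_apply]
    exact hmem B
  rw [hF, LinearEquiv.finrank_map_eq, finrank_iInf_ker_linHom_sub_one]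

end Hom

/-! ### Katz's inequality and its consequences -/

section Index

variable {K : Type*} [Field K] {V : Type*} [AddCommGroup V] [Module K V] {r : ℕ}

/-- **Katz's inequality** ([Katz1996, proof of Thm. 1.1.2]; [Haraoka2020, proof of Thm. 7.8]): for
tuples `T = ρ`, `T' = ρ'` in `GL(V)` with `T'_i ∼ T_i` for all `i` and `T_∞ = T'_∞ = 1`,
`rig(T) ≤ dim Hom(T', T) + dim Hom(T, T')` — Scott's lemma for `σ_i(A) = T_i A T'_i⁻¹` on `End V`.
[cite: Haraoka2020, Theorem 7.8] -/
theorem rigidityIndex_le_finrank_add [FiniteDimensional K V]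
    (ρ ρ' : Representation K (FreeGroup (Fin r)) V)
    (hconj : ∀ i, IsConj (ρ (FreeGroup.of i)) (ρ' (FreeGroup.of i)))
    (h1 : ρ (prodGenerators r) = 1) (h1' : ρ' (prodGenerators r) = 1) :
    rigidityIndex ρ ≤
      (finrank K (ρ'.IntertwiningMap ρ) : ℤ) + (finrank K (ρ.IntertwiningMap ρ') : ℤ) := by
  have hinv : ρ' (prodGenerators r)⁻¹ = 1 := by
    have := map_mul ρ' (prodGenerators r)⁻¹ (prodGenerators r)
    rw [inv_mul_cancel, map_one, h1', mul_one] at this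
    exact this.symm
  have hσT : Representation.linHom ρ' ρ (prodGenerators r) = 1 := by
    apply LinearMap.ext
    intro A
    rw [Representation.linHom_apply, h1, hinv, Module.End.one_apply]
    ext v
    simp
  have hσ1 : (List.ofFn fun i => Representation.linHom ρ' ρ (FreeGroup.of i)).prod = 1 := by
    rw [show (fun i => Representation.linHom ρ' ρ (FreeGroup.of i)) =
        Representation.linHom ρ' ρ ∘ FreeGroup.of from rfl, ← List.map_ofFn, ← map_list_prod]
    exact hσT
  have hS := scott_finrank_le (fun i => Representation.linHom ρ' ρ (FreeGroup.of i)) hσ1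
  have e1 : ∀ i, finrank K (LinearMap.ker (Representation.linHom ρ' ρ (FreeGroup.of i) - 1)) =
      centralizerDim (ρ (FreeGroup.of i)) := fun i =>
    finrank_ker_linHom_sub_one ρ ρ' (FreeGroup.of i) (hconj i)
  simp only [e1, finrank_iInf_ker_dualMap_linHom, finrank_iInf_ker_linHom_sub_one,
    Module.finrank_linearMap K K V V] at hS
  rw [rigidityIndex_eq_of_prodGenerators_eq_one ρ h1]
  have hS' := (Nat.cast_le (α := ℤ)).2 hS
  push_cast at hS'
  linear_combination hS'

/-- **The index of rigidity of an irreducible tuple with `T_∞ = 1` is at most `2`**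
([Haraoka2020, Thm. 7.8, first assertion]; Katz: `rig = 2 - h¹_par ≤ 2`), over an algebraically
closed field: Katz's inequality for `T' = T` and Schur. [cite: Haraoka2020, Theorem 7.8] -/
theorem rigidityIndex_le_two [IsAlgClosed K] [FiniteDimensional K V]
    (ρ : Representation K (FreeGroup (Fin r)) V) (hirr : ρ.IsIrreducible)
    (h1 : ρ (prodGenerators r) = 1) : rigidityIndex ρ ≤ 2 := by
  haveI := hirr
  have h := rigidityIndex_le_finrank_add ρ ρ (fun i => IsConj.refl _) h1 h1
  rw [Representation.IsIrreducible.finrank_intertwiningMap_self] at h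
  simpa using h

/-- **[DettweilerReiter2000, Lemma 4.7], direction "index `2` ⟹ linearly rigid"** (= [Katz1996,
Thm. 1.1.2], cohomologically rigid ⟹ physically rigid; [Haraoka2020, Thm. 7.8, second assertion]),
valid over any field: an irreducible tuple `T` in `GL(V)` with `T_∞ = 1` and `rig(T) = 2` is linearly
rigid.  If `T'_i ∼ T_i` (all `i`) and `T'_∞ ∼ T_∞ = 1` then `T'_∞ = 1`, Katz's inequality gives
`2 ≤ dim Hom(T', T) + dim Hom(T, T')`, and a nonzero intertwiner either way is invertible because
`T` is irreducible. [cite: DettweilerReiter2000, Lemma 4.7] -/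
theorem isLinearlyRigid_of_rigidityIndex_eq_two [FiniteDimensional K V]
    (ρ : Representation K (FreeGroup (Fin r)) V) (hirr : ρ.IsIrreducible)
    (h1 : ρ (prodGenerators r) = 1) (hind : rigidityIndex ρ = 2) : IsLinearlyRigid ρ := by
  intro ρ' hconj hconjinf
  have h1' : ρ' (prodGenerators r) = 1 := by
    rw [h1] at hconjinf
    exact isConj_one_right.1 hconjinf
  have h := rigidityIndex_le_finrank_add ρ ρ' hconj h1 h1'
  rw [hind, ← finrank_iInf_ker_linHom_sub_one ρ ρ', ← finrank_iInf_ker_linHom_sub_one ρ' ρ] at h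
  by_cases hA : (⨅ i, LinearMap.ker (Representation.linHom ρ' ρ (FreeGroup.of i) - 1) :
      Submodule K (Module.End K V)) = ⊥
  · rw [hA, finrank_bot, Nat.cast_zero, zero_add] at h
    have hB : (⨅ i, LinearMap.ker (Representation.linHom ρ ρ' (FreeGroup.of i) - 1) :
        Submodule K (Module.End K V)) ≠ ⊥ := by
      intro hB
      rw [hB, finrank_bot] at h
      norm_num at h
    obtain ⟨B, hBmem, hB0⟩ := (Submodule.ne_bot_iff _).1 hB
    obtain ⟨u, hu⟩ := isUnit_of_mem_iInf_ker_linHom_sub_one' hirr hBmem hB0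
    refine ⟨u, fun i => ?_⟩
    rw [SemiconjBy, hu]
    exact (((mem_ker_linHom_sub_one_iff ρ' ρ _ B).1 ((Submodule.mem_iInf _).1 hBmem i))).symm
  · obtain ⟨A, hAmem, hA0⟩ := (Submodule.ne_bot_iff _).1 hA
    obtain ⟨u, hu⟩ := isUnit_of_mem_iInf_ker_linHom_sub_one hirr hAmem hA0
    refine ⟨u⁻¹, fun i => ?_⟩
    apply SemiconjBy.units_inv_symm_left
    rw [SemiconjBy, hu]
    exact (((mem_ker_linHom_sub_one_iff ρ ρ' _ A).1 ((Submodule.mem_iInf _).1 hAmem i))).symm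

end Index

end RigidTuple

/-! ### Consequences for the named fact `DettweilerReiter2000_lemma_4_7` -/

section NamedFacts

open RigidTuple

/-- The direction "⟸" of `DettweilerReiter2000_lemma_4_7`, over any field.
[cite: DettweilerReiter2000, Lemma 4.7] -/
theorem DettweilerReiter2000_lemma_4_7_mpr {K : Type u} [Field K] {V : Type v} [AddCommGroup V]
    [Module K V] [FiniteDimensional K V] {r : ℕ} (ρ : Representation K (FreeGroup (Fin r)) V)
    (hirr : ρ.IsIrreducible) (h1 : ρ (prodGenerators r) = 1) (hind : rigidityIndex ρ = 2) :
    IsLinearlyRigid ρ :=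
  isLinearlyRigid_of_rigidityIndex_eq_two ρ hirr h1 hind

/-- `DettweilerReiter2000_lemma_4_7` is equivalent to its remaining direction "linearly rigid ⟹
`rig ≥ 2`" ([StrambachVolklein1999]; [Haraoka2020, Thm. 7.8, third part] — a dimension count of
algebraic varieties): the index is `≤ 2` for every irreducible tuple (`rigidityIndex_le_two`) and
`= 2` forces linear rigidity (`isLinearlyRigid_of_rigidityIndex_eq_two`).
[cite: DettweilerReiter2000, Lemma 4.7] -/
theorem DettweilerReiter2000_lemma_4_7_iff_two_le :
    DettweilerReiter2000_lemma_4_7.{u, v} ↔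
      ∀ (K : Type u) [Field K] [IsAlgClosed K] (V : Type v) [AddCommGroup V] [Module K V]
        [FiniteDimensional K V] (r : ℕ) (ρ : Representation K (FreeGroup (Fin r)) V),
        ρ.IsIrreducible → ρ (prodGenerators r) = 1 → IsLinearlyRigid ρ → 2 ≤ rigidityIndex ρ := by
  constructor
  · intro h K _ _ V _ _ _ r ρ hirr h1 hrig
    exact ((h K V r ρ hirr h1).1 hrig).ge
  · intro h K _ _ V _ _ _ r ρ hirr h1
    exact ⟨fun hrig => le_antisymm (rigidityIndex_le_two ρ hirr h1) (h K V r ρ hirr h1 hrig),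
      fun hind => isLinearlyRigid_of_rigidityIndex_eq_two ρ hirr h1 hind⟩

/-- Since the index of rigidity is even (`RigidTuple.even_rigidityIndex`), the named fact is
equivalent to "linearly rigid ⟹ `rig > 0`" — the form in which the dimension count
`dim (SL_n × ∏ Z(T_i)) ≥ dim π⁻¹(1)` of [Haraoka2020, Thm. 7.8, third part] delivers it without the
stabiliser correction. [cite: DettweilerReiter2000, Lemma 4.7] -/
theorem DettweilerReiter2000_lemma_4_7_iff_pos :
    DettweilerReiter2000_lemma_4_7.{u, v} ↔
      ∀ (K : Type u) [Field K] [IsAlgClosed K] (V : Type v) [AddCommGroup V] [Module K V]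
        [FiniteDimensional K V] (r : ℕ) (ρ : Representation K (FreeGroup (Fin r)) V),
        ρ.IsIrreducible → ρ (prodGenerators r) = 1 → IsLinearlyRigid ρ → 0 < rigidityIndex ρ := by
  rw [DettweilerReiter2000_lemma_4_7_iff_two_le]
  refine forall_congr' fun K => forall_congr' fun _ => forall_congr' fun _ => forall_congr' fun V =>
    forall_congr' fun _ => forall_congr' fun _ => forall_congr' fun _ => forall_congr' fun r =>
    forall_congr' fun ρ => forall_congr' fun _ => forall_congr' fun _ => forall_congr' fun _ => ?_
  constructor
  · intro h
    omega
  · intro h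
    obtain ⟨k, hk⟩ := even_rigidityIndex ρ
    omega

/-- **Katz's algorithm from the numerical criterion, with Lemma 4.7 discharged where it is used**:
under the named fact `DettweilerReiter2000_thm_4_9` alone, an irreducible tuple with `T_∞ = 1` and
index of rigidity `2` over an algebraically closed field is connected to rank one by multiplications
and middle convolutions (compare `DettweilerReiter2000_thm_4_9.of_rigidityIndex_eq_two`, which also
assumed `DettweilerReiter2000_lemma_4_7`). [cite: DettweilerReiter2000, Theorem 4.9] -/
theorem DettweilerReiter2000_thm_4_9.of_rigidityIndex_eq_two'
    (h : DettweilerReiter2000_thm_4_9.{u, v}) {K : Type u} [Field K] [IsAlgClosed K] {V : Type v}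
    [AddCommGroup V] [Module K V] [FiniteDimensional K V] {r : ℕ}
    {ρ : Representation K (FreeGroup (Fin r)) V}
    (hirr : ρ.IsIrreducible) (h1 : ρ (prodGenerators r) = 1) (hind : rigidityIndex ρ = 2) :
    ReducesToRankOne K r V ρ :=
  h K V r ρ hirr h1 (isLinearlyRigid_of_rigidityIndex_eq_two ρ hirr h1 hind)

end NamedFacts

end Literature.AlgebraicGeometry.Motives

end
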